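import Mathlib.Algebra.Module.ZLattice.Summable
import Mathlib.Probability.ProbabilityMassFunction.Constructions
import Mathlib.Analysis.Complex.Exponential
import Literature.Algebra.EuclideanLattices.DualLattice
import HarnessLib

-- provenance: harness21/H21/H21/Prelude/Lattice/DiscreteGaussian.lean @ 884d84e (interim HEAD d8f2665); M5 mechanical rewrite
/-!
# Discrete Gaussians on lattices and the smoothing parameter (trunk T-LATTICE, G10)

For a real inner product space `E`, a parameter `s : ℝ` and `x : E`, the *Gaussian function* is
`ρ_s(x) = exp (-π ‖x‖² / s²)` (Micciancio–Regev 2007, §2).  For a countable set `A ⊆ E` and a centre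
`c`, `ρ_{s,c}(A) = ∑_{x ∈ A} ρ_s(x - c)`.  When `L ⊆ E` is a discrete `ℤ`-submodule of a
finite-dimensional space, `ρ_{s,c}(L)` is finite and nonzero, and the *discrete Gaussian*
`D_{L,s,c}` is the probability mass function on `L` proportional to `x ↦ ρ_s(x - c)`
(Micciancio–Regev 2007 §2; Gentry–Peikert–Vaikuntanathan 2008 §2; Regev 2009 §2).  The *smoothing
parameter* `η_ε(L)` is the infimum of all `s > 0` with `ρ_{1/s}(L* ∖ {0}) ≤ ε`
(Micciancio–Regev 2007, Def. 3.1).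

## Mathlib

Mathlib has no discrete Gaussian on a lattice (`rg discreteGaussian|gaussianFunction` finds nothing;
`ProbabilityTheory.gaussianReal` is the continuous Gaussian on `ℝ`).  We use `PMF.normalize`
(`Mathlib/Probability/ProbabilityMassFunction/Constructions.lean`), the lattice summability lemma
`ZLattice.summable_norm_sub_inv_pow` (`Mathlib/Algebra/Module/ZLattice/Summable.lean`), and
`Real.pow_div_factorial_le_exp` for the tail comparison `exp (-t) ≤ k! / t^k`.

## Design

* Generality: `gaussianFunction`/`gaussianMass` need only `[NormedAddCommGroup E]`; the lattice
  results use `[NormedSpace ℝ E] [FiniteDimensional ℝ E] [DiscreteTopology L]` (as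
  `ZLattice.summable_norm_sub_inv_pow`); the smoothing parameter needs `[InnerProductSpace ℝ F]`
  for the dual lattice.
* `gaussianMass s c A : ℝ≥0∞` is an unconditional `tsum` in `ℝ≥0∞` (always defined, no summability
  side conditions).
* `summable_gaussianFunction_sub` has a real proof since it feeds the definition `discreteGaussian`
  through `gaussianMass_lattice_ne_top`.
* `discreteGaussian L s c` is defined by `dite (0 < s)`; for `s ≤ 0` it is the junk value
  `PMF.pure 0` (documented on the definition).  All API lemmas assume `0 < s`.
* `smoothingParameter L ε` is an `sInf` over a subset of `(0, ∞)`; it is `0` when that set is empty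
  (e.g. `ε ≤ 0`), by `Real.sInf_empty`.

## References

* D. Micciancio, O. Regev, *Worst-case to average-case reductions based on Gaussian measures*,
  SIAM J. Comput. 37 (2007), §2 and Def. 3.1.
* C. Gentry, C. Peikert, V. Vaikuntanathan, *Trapdoors for hard lattices and new cryptographic
  constructions*, STOC 2008, §2.
* O. Regev, *On lattices, learning with errors, random linear codes, and cryptography*, J. ACM 56
  (2009), §2.
-/

noncomputable section

open scoped ENNReal
open Real

namespace Literature.Algebra.EuclideanLattices

section Lattice

variable {E : Type*} [NormedAddCommGroup E]

/-! ### The Gaussian function `ρ_s` -/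

/-- The Gaussian function `ρ_s(x) = exp (-π ‖x‖² / s²)` of parameter `s` on a real normed group
(in applications an inner product space) (Micciancio–Regev 2007, §2).  For `s = 0` this is the
junk value `exp 0 = 1` (division by zero). [cite: MicciancioRegev2007, §2] -/
def gaussianFunction (s : ℝ) (x : E) : ℝ :=
  Real.exp (-π * ‖x‖ ^ 2 / s ^ 2)

/-- `ρ_s(x) > 0` (Micciancio–Regev 2007, §2). [cite: MicciancioRegev2007, §2] -/
theorem gaussianFunction_pos (s : ℝ) (x : E) : 0 < gaussianFunction s x :=
  Real.exp_pos _

/-- `ρ_s(x) ≤ 1` (Micciancio–Regev 2007, §2). [cite: MicciancioRegev2007, §2] -/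
theorem gaussianFunction_le_one (s : ℝ) (x : E) : gaussianFunction s x ≤ 1 := by
  refine Real.exp_le_one_iff.mpr ?_
  have : 0 ≤ π * ‖x‖ ^ 2 / s ^ 2 := by positivity
  rw [neg_mul, neg_div]
  linarith

/-- `ρ_s(0) = 1` (Micciancio–Regev 2007, §2). [cite: MicciancioRegev2007, §2] -/
@[simp]
theorem gaussianFunction_zero (s : ℝ) : gaussianFunction s (0 : E) = 1 := by
  simp [gaussianFunction]

/-- `ρ_s` is even: `ρ_s(-x) = ρ_s(x)` (Micciancio–Regev 2007, §2). [cite: MicciancioRegev2007, §2] -/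
@[simp]
theorem gaussianFunction_neg (s : ℝ) (x : E) : gaussianFunction s (-x) = gaussianFunction s x := by
  simp [gaussianFunction]

/-- Scaling: `ρ_{a s}(a x) = ρ_s(x)` for `a ≠ 0` (Micciancio–Regev 2007, §2). [cite: MicciancioRegev2007, §2] -/
theorem gaussianFunction_smul [NormedSpace ℝ E] (s : ℝ) {a : ℝ} (ha : a ≠ 0) (x : E) :
    gaussianFunction (a * s) (a • x) = gaussianFunction s x := by
  simp only [gaussianFunction, norm_smul, Real.norm_eq_abs, mul_pow, sq_abs]
  congr 1
  have : a ^ 2 ≠ 0 := pow_ne_zero 2 ha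
  field_simp

/-- `ρ_s(x)` is monotone in the parameter on `(0, ∞)`: `0 < s ≤ t → ρ_s(x) ≤ ρ_t(x)`
(Micciancio–Regev 2007, §2). [cite: MicciancioRegev2007, §2] -/
theorem gaussianFunction_mono_left {s t : ℝ} (hs : 0 < s) (hst : s ≤ t) (x : E) :
    gaussianFunction s x ≤ gaussianFunction t x := by
  refine Real.exp_le_exp.mpr ?_
  rw [neg_mul, neg_div, neg_div, neg_le_neg_iff]
  exact div_le_div_of_nonneg_left (by positivity) (by positivity) (pow_le_pow_left₀ hs.le hst 2)

/-- Tail comparison feeding summability: for `s ≠ 0`, `x ≠ 0` and any `k`,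
`ρ_s(x) ≤ k! (s²/π)^k ‖x‖⁻¹^(2k)`, from `t^k / k! ≤ exp t` with `t = π‖x‖²/s²`
(Micciancio–Regev 2007, §2; elementary). [cite: MicciancioRegev2007, §2] -/
theorem gaussianFunction_le_inv_pow {s : ℝ} (hs : s ≠ 0) (k : ℕ) {x : E} (hx : x ≠ 0) :
    gaussianFunction s x ≤ (k.factorial : ℝ) * (s ^ 2 / π) ^ k * ‖x‖⁻¹ ^ (2 * k) := by
  have hxn : 0 < ‖x‖ := norm_pos_iff.mpr hx
  have ht : 0 < π * ‖x‖ ^ 2 / s ^ 2 := by positivity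
  have h := Real.pow_div_factorial_le_exp _ ht.le k
  have hk : (0 : ℝ) < k.factorial := by exact_mod_cast k.factorial_pos
  rw [gaussianFunction, neg_mul, neg_div, Real.exp_neg]
  calc (Real.exp (π * ‖x‖ ^ 2 / s ^ 2))⁻¹
      ≤ ((π * ‖x‖ ^ 2 / s ^ 2) ^ k / k.factorial)⁻¹ := by
        gcongr
    _ = (k.factorial : ℝ) * (s ^ 2 / π) ^ k * ‖x‖⁻¹ ^ (2 * k) := by
        have hπ : (π : ℝ) ≠ 0 := Real.pi_ne_zero
        have hs2 : s ^ 2 ≠ 0 := pow_ne_zero 2 hs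
        have hx2 : ‖x‖ ^ 2 ≠ 0 := by positivity
        rw [inv_div, div_pow, div_pow, mul_pow, pow_mul, inv_pow]
        field_simp
        rw [← mul_pow, mul_one_div_cancel hx2, one_pow]

/-! ### Gaussian mass of a set -/

/-- The Gaussian mass `ρ_{s,c}(A) = ∑_{x ∈ A} ρ_s(x - c) ∈ [0, ∞]` of a set `A ⊆ E` with centre `c`,
as an unconditional sum in `ℝ≥0∞` (Micciancio–Regev 2007, §2). [cite: MicciancioRegev2007, §2] -/
def gaussianMass (s : ℝ) (c : E) (A : Set E) : ℝ≥0∞ :=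
  ∑' x : A, ENNReal.ofReal (gaussianFunction s ((x : E) - c))

/-- Monotonicity of the Gaussian mass in the set: `A ⊆ B → ρ_{s,c}(A) ≤ ρ_{s,c}(B)`
(Micciancio–Regev 2007, §2). [cite: MicciancioRegev2007, §2] -/
theorem gaussianMass_mono (s : ℝ) (c : E) {A B : Set E} (h : A ⊆ B) :
    gaussianMass s c A ≤ gaussianMass s c B :=
  ENNReal.tsum_mono_subtype (fun x : E => ENNReal.ofReal (gaussianFunction s (x - c))) h

/-- Monotonicity of the Gaussian mass in the parameter: `0 < s ≤ t → ρ_{s,c}(A) ≤ ρ_{t,c}(A)`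
(Micciancio–Regev 2007, §2). [cite: MicciancioRegev2007, §2] -/
theorem gaussianMass_mono_left {s t : ℝ} (hs : 0 < s) (hst : s ≤ t) (c : E) (A : Set E) :
    gaussianMass s c A ≤ gaussianMass t c A :=
  ENNReal.tsum_le_tsum fun _ => ENNReal.ofReal_le_ofReal (gaussianFunction_mono_left hs hst _)

/-- The mass `s ↦ ρ_{1/s,c}(A)` is antitone on `(0, ∞)` (Micciancio–Regev 2007, §3, remark after
Def. 3.1). [cite: MicciancioRegev2007, §3  remark after Def. 3.1] -/
theorem gaussianMass_inv_antitoneOn (c : E) (A : Set E) :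
    AntitoneOn (fun s : ℝ => gaussianMass s⁻¹ c A) (Set.Ioi 0) :=
  fun _ ha _ hb hab => gaussianMass_mono_left (inv_pos.mpr hb) (inv_anti₀ ha hab) c A

/-! ### Summability over a lattice -/

section Lattice

variable [NormedSpace ℝ E] [FiniteDimensional ℝ E] (L : Submodule ℤ E) [DiscreteTopology L]

/-- For a discrete subgroup `L` of a finite-dimensional real normed space and `s ≠ 0`, the
Gaussian `x ↦ ρ_s(x - c)` is summable over `L` (Micciancio–Regev 2007, §2; Banaszczyk 1993, §1).
Proof: `ρ_s(x - c) ≤ C ‖x - c‖⁻¹^(2k)` off the (at most one) point `x = c`, and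
`ZLattice.summable_norm_sub_inv_pow`. [cite: MicciancioRegev2007, §2] -/
theorem summable_gaussianFunction_sub {s : ℝ} (hs : s ≠ 0) (c : E) :
    Summable (fun x : L => gaussianFunction s ((x : E) - c)) := by
  set k : ℕ := Module.finrank ℤ L + 1
  have hk : Module.finrank ℤ L < 2 * k := by omega
  refine Summable.of_norm_bounded_eventually
    ((ZLattice.summable_norm_sub_inv_pow L (2 * k) hk c).mul_left
      ((k.factorial : ℝ) * (s ^ 2 / π) ^ k)) ?_
  have hfin : ({x : L | (x : E) = c} : Set L).Finite :=
    Set.Subsingleton.finite fun x hx y hy => Subtype.ext (hx.trans hy.symm)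
  refine Filter.mem_of_superset hfin.compl_mem_cofinite fun x hx => ?_
  have hx' : (x : E) - c ≠ 0 := sub_ne_zero.mpr hx
  simp only [Set.mem_setOf_eq]
  rw [Real.norm_of_nonneg (gaussianFunction_pos s _).le]
  exact gaussianFunction_le_inv_pow hs k hx'

/-- The Gaussian mass of a discrete subgroup is finite: `ρ_{s,c}(L) < ∞` for `s ≠ 0`
(Micciancio–Regev 2007, §2). [cite: MicciancioRegev2007, §2] -/
theorem gaussianMass_lattice_ne_top {s : ℝ} (hs : s ≠ 0) (c : E) :
    gaussianMass s c (L : Set E) ≠ ∞ :=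
  (summable_gaussianFunction_sub L hs c).tsum_ofReal_ne_top

omit [NormedSpace ℝ E] [FiniteDimensional ℝ E] [DiscreteTopology L] in
/-- The Gaussian mass of a submodule is nonzero: `ρ_{s,c}(L) ≠ 0` (the term at `0 ∈ L` is
positive) (Micciancio–Regev 2007, §2). [cite: MicciancioRegev2007, §2] -/
theorem gaussianMass_lattice_ne_zero (s : ℝ) (c : E) : gaussianMass s c (L : Set E) ≠ 0 := by
  rw [gaussianMass, ne_eq, ENNReal.tsum_eq_zero, not_forall]
  exact ⟨⟨0, L.zero_mem⟩, by simpa using gaussianFunction_pos s _⟩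

/-! ### The discrete Gaussian distribution -/

/-- The discrete Gaussian distribution `D_{L,s,c}` on a discrete subgroup `L` of a
finite-dimensional real normed space: the probability mass function on `L` with
`D_{L,s,c}(x) = ρ_s(x - c) / ρ_{s,c}(L)` (Micciancio–Regev 2007, §2; Gentry–Peikert–Vaikuntanathan
2008, §2; Regev 2009, §2).  The coset version `D_{L+c,s}` of the literature is the image of
`discreteGaussian L s (-c)` under `x ↦ x + c`, i.e. `c + D_{L,s,-c}`.  Junk value: for `s ≤ 0` it
is the point mass at `0`. [cite: MicciancioRegev2007, §2] -/
def discreteGaussian (s : ℝ) (c : E) : PMF L :=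
  if h : 0 < s then
    PMF.normalize (fun x : L => ENNReal.ofReal (gaussianFunction s ((x : E) - c)))
      (gaussianMass_lattice_ne_zero L s c) (gaussianMass_lattice_ne_top L h.ne' c)
  else PMF.pure 0

/-- The discrete Gaussian at a point: `D_{L,s,c}(x) = ρ_s(x - c) · ρ_{s,c}(L)⁻¹` for `0 < s`
(Micciancio–Regev 2007, §2). [cite: MicciancioRegev2007, §2] -/
theorem discreteGaussian_apply {s : ℝ} (hs : 0 < s) (c : E) (x : L) :
    discreteGaussian L s c x =
      ENNReal.ofReal (gaussianFunction s ((x : E) - c)) * (gaussianMass s c (L : Set E))⁻¹ := by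
  rw [discreteGaussian, dif_pos hs, PMF.normalize_apply]
  rfl

/-- The discrete Gaussian has full support: every lattice point has positive probability for
`0 < s` (Micciancio–Regev 2007, §2). [cite: MicciancioRegev2007, §2] -/
@[simp]
theorem support_discreteGaussian {s : ℝ} (hs : 0 < s) (c : E) :
    (discreteGaussian L s c).support = Set.univ := by
  rw [discreteGaussian, dif_pos hs, PMF.support_normalize, Set.eq_univ_iff_forall]
  intro x
  simpa using gaussianFunction_pos s _

end Lattice

/-! ### The smoothing parameter -/

section Smoothing

variable {F : Type*} [NormedAddCommGroup F] [InnerProductSpace ℝ F] (L : Submodule ℤ F)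

/-- The smoothing parameter `η_ε(L) = inf {s > 0 | ρ_{1/s}(L* ∖ {0}) ≤ ε}` of a lattice
(Micciancio–Regev 2007, Def. 3.1), where `L*` is `Literature.Lattice.dualLattice L`.  Junk value `0` when
the defining set is empty (e.g. `ε ≤ 0`). [cite: MicciancioRegev2007, Def. 3.1] -/
def smoothingParameter (ε : ℝ) : ℝ :=
  sInf {s : ℝ | 0 < s ∧
    gaussianMass (1 / s) 0 ((dualLattice L : Set F) \ {0}) ≤ ENNReal.ofReal ε}

/-- `0 ≤ η_ε(L)` (Micciancio–Regev 2007, Def. 3.1). [cite: MicciancioRegev2007, Def. 3.1] -/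
theorem smoothingParameter_nonneg (ε : ℝ) : 0 ≤ smoothingParameter L ε :=
  Real.sInf_nonneg fun _ hs => hs.1.le

/-- The dual Gaussian mass `s ↦ ρ_{1/s}(L* ∖ {0})` is antitone on `(0, ∞)`: increasing `s` shrinks
`ρ_{1/s}` pointwise (Micciancio–Regev 2007, §3, remark after Def. 3.1).  Special case of
`gaussianMass_inv_antitoneOn`. [cite: MicciancioRegev2007, §3  remark after Def. 3.1] -/
theorem gaussianMass_dual_antitone :
    AntitoneOn (fun s : ℝ => gaussianMass (1 / s) (0 : F) ((dualLattice L : Set F) \ {0}))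
      (Set.Ioi 0) := by
  simpa only [one_div] using gaussianMass_inv_antitoneOn (0 : F) _

/-- Characterisation of lower bounds: for `0 < ε` and a full-rank lattice, `t ≤ η_ε(L)` iff every
`s > 0` with `ρ_{1/s}(L* ∖ {0}) ≤ ε` satisfies `t ≤ s` (Micciancio–Regev 2007, Def. 3.1; the
defining set is nonempty by `ρ_{1/s}(L* ∖ {0}) → 0` as `s → ∞`, ibid. §3). [cite: MicciancioRegev2007, Def. 3.1] -/
def le_smoothingParameter_iff : Prop :=
  ∀ [FiniteDimensional ℝ F] [DiscreteTopology L] [IsZLattice ℝ L] {ε : ℝ} (hε : 0 < ε) (t : ℝ),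
    t ≤ smoothingParameter L ε ↔ ∀ s : ℝ, 0 < s →
      gaussianMass (1 / s) 0 ((dualLattice L : Set F) \ {0}) ≤ ENNReal.ofReal ε → t ≤ s

/-- The smoothing parameter of a full-rank lattice in a nontrivial space is positive:
`0 < η_ε(L)` for `0 < ε` (Micciancio–Regev 2007, §3: `ρ_{1/s}(L* ∖ {0}) → ∞` as `s → 0⁺`, which
uses `L* ∖ {0} ≠ ∅`, i.e. dimension `n ≥ 1`, tacit in MR07).  `[Nontrivial F]` is needed: in the
zero space `L* ∖ {0} = ∅` and `η_ε(L) = sInf (0, ∞) = 0`. [cite: MicciancioRegev2007, §3:  ρ_{1/s}(L  ∖ {0}] -/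
def smoothingParameter_pos : Prop :=
  ∀ [Nontrivial F] [FiniteDimensional ℝ F] [DiscreteTopology L] [IsZLattice ℝ L] {ε : ℝ} (hε : 0 < ε),
    0 < smoothingParameter L ε

/-- The infimum in `η_ε(L)` is attained: `ρ_{1/η_ε(L)}(L* ∖ {0}) ≤ ε` for `0 < ε` and a full-rank
lattice, so `η_ε(L) = min {s > 0 | ρ_{1/s}(L* ∖ {0}) ≤ ε}` (Micciancio–Regev 2007, Def. 3.1; lower
semicontinuity of the mass in `s`).  In the zero space both sides degenerate (`L* ∖ {0} = ∅`, mass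
`0`), so no `Nontrivial F` hypothesis is needed. [cite: MicciancioRegev2007, Def. 3.1] -/
def gaussianMass_dual_smoothingParameter_le : Prop :=
  ∀ [FiniteDimensional ℝ F] [DiscreteTopology L] [IsZLattice ℝ L] {ε : ℝ} (hε : 0 < ε),
    gaussianMass (1 / smoothingParameter L ε) 0 ((dualLattice L : Set F) \ {0}) ≤
      ENNReal.ofReal ε

/-- Above the smoothing parameter the dual mass is at most `ε`: if `η_ε(L) < s` then
`ρ_{1/s}(L* ∖ {0}) ≤ ε` (Micciancio–Regev 2007, Def. 3.1 with the monotonicity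
`gaussianMass_dual_antitone`). [cite: MicciancioRegev2007, Def. 3.1 with the monotonicity  gaussian] -/
def gaussianMass_dual_le_of_smoothingParameter_lt : Prop :=
  ∀ [FiniteDimensional ℝ F] [DiscreteTopology L] [IsZLattice ℝ L] {ε s : ℝ} (hε : 0 < ε) (hs : smoothingParameter L ε < s),
    gaussianMass (1 / s) 0 ((dualLattice L : Set F) \ {0}) ≤ ENNReal.ofReal ε

end Smoothing

end Lattice

end Literature.Algebra.EuclideanLattices
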